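import Literature.AlgebraicGeometry.Resolution.NearPointsPointCentreUnique
import Literature.AlgebraicGeometry.Resolution.NearPointsCurveCentre
import Literature.AlgebraicGeometry.Resolution.BlowupOffCentre
import Literature.AlgebraicGeometry.Resolution.BlowupsExistence
import Literature.AlgebraicGeometry.Resolution.BlowupsProperProofs
import Literature.AlgebraicGeometry.Resolution.RegularBlowup
import Literature.AlgebraicGeometry.Resolution.SubschemeRegularStalks
import Literature.AlgebraicGeometry.Resolution.PermissibleCentres
import Literature.AlgebraicGeometry.Resolution.RegularSystemOfParameters
import HarnessLib

/-!
# The local structure of `Σ = {ord ≥ μ}` at points with `τ ≥ 2` (CoP1, Lemma 4.3 (1), (2): the "moreover" clauses)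

Topic: `Literature/AlgebraicGeometry/Resolution`. [CoP1] = Cossart–Piltant, J. Algebra 320 (2008)
1051–1082, Lemma 4.3, p. 8, for the blowing up `q : X′ → X` of a regular threefold along a centre
`Y` permissible for the idealistic exponent `E = (J, μ)` at `x`, `Σ` its singular locus
`{ord_x J = μ}` (`μ` the maximal order):

> "(1) If `τ(x) = 3`, then `Y = {x}` and no `x′ ∈ q⁻¹(x)` is near `x`. **Moreover `x` is an
> isolated point of `Σ`.** (2) If `τ(x) = 2` and `Y` is a curve, then no `x′ ∈ q⁻¹(x)` is near
> `x`. **Moreover `Y` and `Σ` coincide locally at `x`.**"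

The near-point halves are in the tree (`NearPointsPointCentre.lean`, `NearPointsCurveCentre.lean`).
PROVED here are the "moreover" clauses, by the mechanism of the proof of [CoP1] Prop. 4.4, p. 9–10
("the strict transform of `Σ` in `X′` …"): a point `ζ ∈ Σ` specializing to `x` and off the centre
lifts to the blowing up with the same order (the blowing up is an isomorphism off its centre), and
— the blowing up being a CLOSED map — its lift specializes to a point `x′` over `x`, which has
order `≥ μ` (orders do not decrease under specialization) and `≤ μ` (over a permissible centre),
i.e. is NEAR. So near points detect the branches of `Σ` through `x`:

* `IsBlowup.exists_preimage_of_not_mem_support` — a blowing up is onto off its centre.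
* `IsBlowup.exists_isNear_of_specializes` — **every point of `Σ′ = {ord J′ ≥ μ}` whose image
  specializes to `x ∈ Y` specializes to a NEAR point over `x`.**
* `IsBlowup.exists_isNear_of_specializes_of_not_mem` — hence every `ζ ∈ Σ ∖ Y` specializing to
  `x ∈ Y` yields a near point over `x` to which the lift of `ζ` specializes.
* `eq_of_specializes_of_stalkTau_eq_three` — **Lemma 4.3 (1), moreover: at a closed point `x` of
  embedding dimension `3` with `ord_x J = μ` and `τ(x) = 3`, `x` is an ISOLATED point of `Σ`** (no
  generization `ζ ≠ x` of `x` has `ord_ζ J ≥ μ`).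
* `mem_of_specializes_of_two_le_stalkTau` — **Lemma 4.3 (2), moreover: if `Y ⊆ Σ` is a regular
  curve through `x` (codimension-`2` part of a regular system of parameters at `x`, `ord = μ` along
  `Y`) and `τ(x) ≥ 2`, then `Σ` and `Y` coincide locally at `x`** (every generization of `x` in `Σ`
  lies on `Y`).
* `IsBlowup.specializes_of_isNear_of_stalkTau_eq_two` — the point-centre case with `τ(x) = 2`
  (input of the termination argument of Prop. 4.4): every point of `Σ′` whose image specializes to
  `x` specializes to THE near point over `x` (uniqueness, `NearPointsPointCentreUnique.lean`) — the
  strict transform of every branch of `Σ` through `x` passes through the near point.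

## Sources

* V. Cossart, O. Piltant, J. Algebra 320 (2008) 1051–1082, Lemma 4.3 (1), (2), p. 8; proof of
  Prop. 4.4, p. 9–10. [CossartPiltant2008]
* U. Görtz, T. Wedhorn, *Algebraic Geometry I*, 2nd ed. (2020), Prop. 13.91 (3). [GortzWedhorn2020]
-/

noncomputable section

open CategoryTheory CategoryTheory.Limits AlgebraicGeometry TopologicalSpace IsLocalRing

namespace Literature.AlgebraicGeometry.Resolution

universe u

open Scheme.IdealSheafData

variable {X X' : Scheme.{u}} {π : X' ⟶ X}

/-! ## Plumbing: lifting points off the centre, specializing along a closed map -/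

/-- **A blowing up is onto off its centre** (it restricts to an isomorphism over the complement
of the centre, Görtz–Wedhorn I, Prop. 13.91 (3)). [cite: GortzWedhorn2020, Prop. 13.91 (3)] -/
theorem IsBlowup.exists_preimage_of_not_mem_support {C : X.IdealSheafData} (hπ : IsBlowup π C)
    {z : X} (hz : z ∉ (C.support : Set X)) : ∃ z' : X', π z' = z := by
  set W : X.Opens := ⟨(C.support : Set X)ᶜ, C.support.isClosed.isOpen_compl⟩ with hW
  haveI : IsIso (π ∣_ W) := hπ.isIso_compl
  obtain ⟨z', hz'⟩ := (ConcreteCategory.bijective_of_isIso ((π ∣_ W).base)).2 ⟨z, hz⟩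
  refine ⟨z'.1, ?_⟩
  have := congrArg Subtype.val hz'
  rwa [morphismRestrict_base_coe] at this

/-- Along a universally closed morphism, a point whose image specializes to `x` specializes to a
point over `x` (private plumbing: the image of a closure is closed). [folklore] -/
private theorem exists_specializes_and_apply_eq (f : X' ⟶ X) [UniversallyClosed f] (ζ' : X')
    {x : X} (h : f ζ' ⤳ x) : ∃ x' : X', ζ' ⤳ x' ∧ f x' = x := by
  have hcl : IsClosed (f.base '' closure {ζ'}) := f.isClosedMap _ isClosed_closure
  have hx : x ∈ f.base '' closure {ζ'} := by
    refine closure_minimal ?_ hcl (specializes_iff_mem_closure.mp h)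
    rintro _ rfl
    exact ⟨ζ', subset_closure rfl, rfl⟩
  obtain ⟨x', hx', rfl⟩ := hx
  exact ⟨x', specializes_iff_mem_closure.mpr hx', rfl⟩

/-- The reduced one-point subscheme on a closed point of a locally Noetherian scheme is regular
(private copy of a campaign plumbing lemma; its local ring is the residue field). [folklore] -/
private theorem isRegular_subscheme_vanishingIdeal_point [IsLocallyNoetherian X] {x : X}
    (hx : IsClosed ({x} : Set X)) : Scheme.IsRegular (vanishingIdeal ⟨{x}, hx⟩).subscheme := by
  refine Scheme.isRegular_subscheme_of_forall _ fun y hy => ?_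
  rw [← SetLike.mem_coe, coe_support_vanishingIdeal] at hy
  have hy' : y = x := hy
  subst hy'
  rw [stalkIdeal_vanishingIdeal_singleton hx]
  letI := Ideal.Quotient.field (maximalIdeal (X.presheaf.stalk y))
  infer_instance

/-! ## Near points detect the branches of `Σ` through the centre -/

/-- **Every point of `Σ′` whose image specializes to a point of the centre specializes to a near
point.** `X, X′` locally Noetherian, `X` regular, `π` the blowing up along a regular centre `Y`
with `ord_y J = μ` along `Y`, `X′` regular; if `ζ′ ∈ X′` has `ord_{ζ′} J′ ≥ μ` (`J′` the weak
transform) and `π ζ′ ⤳ x ∈ Y`, then `ζ′ ⤳ x′` for some NEAR point `x′` over `x` (`π` is a closed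
map; orders do not decrease under specialization and are `≤ μ` over the centre).
[cite: CossartPiltant2008, proof of Prop. 4.4, p. 9–10] -/
theorem IsBlowup.exists_isNear_of_specializes [IsLocallyNoetherian X] [IsLocallyNoetherian X']
    (hX : Scheme.IsRegular X) (hX' : Scheme.IsRegular X') {Y : Closeds X}
    (hreg : Scheme.IsRegular (vanishingIdeal Y).subscheme) (hπ : IsBlowup π (vanishingIdeal Y))
    {J : X.IdealSheafData} {μ : ℕ} (hY : ∀ y ∈ (Y : Set X), idealOrder J y = μ) {x : X}
    (hx : x ∈ (Y : Set X)) {ζ' : X'} (hζ : π ζ' ⤳ x)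
    (hord : (μ : ℕ∞) ≤ idealOrder (controlledTransform π (vanishingIdeal Y) J μ) ζ') :
    ∃ x' : X', ζ' ⤳ x' ∧ π x' = x ∧ IsNear π (vanishingIdeal Y) J μ x' := by
  haveI : IsProper π := hπ.isProper
  obtain ⟨x', hsp, hx'⟩ := exists_specializes_and_apply_eq π ζ' hζ
  haveI : IsRegularLocalRing (X'.presheaf.stalk x') := hX' x'
  have hge : (μ : ℕ∞) ≤ idealOrder (controlledTransform π (vanishingIdeal Y) J μ) x' :=
    hord.trans (idealOrder_le_of_specializes hsp _)
  have hle : idealOrder (controlledTransform π (vanishingIdeal Y) J μ) x' ≤ μ :=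
    hπ.idealOrder_controlledTransform_le_of_mem hX hreg hY (by rw [hx']; exact hx)
  exact ⟨x', hsp, hx', isNear_iff.mpr (le_antisymm hle hge)⟩

/-- **A point of `Σ` off the centre specializing to `x ∈ Y` yields a near point over `x`**, to
which its lift specializes: `ζ ∉ Y`, `ζ ⤳ x`, `ord_ζ J ≥ μ` ⟹ `∃ ζ′ x′`, `π ζ′ = ζ`, `ζ′ ⤳ x′`,
`π x′ = x`, `x′` near (the blowing up is onto off `Y` with unchanged orders there).
[cite: CossartPiltant2008, proof of Prop. 4.4, p. 9–10] -/
theorem IsBlowup.exists_isNear_of_specializes_of_not_mem [IsLocallyNoetherian X]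
    [IsLocallyNoetherian X'] (hX : Scheme.IsRegular X) (hX' : Scheme.IsRegular X') {Y : Closeds X}
    (hreg : Scheme.IsRegular (vanishingIdeal Y).subscheme) (hπ : IsBlowup π (vanishingIdeal Y))
    {J : X.IdealSheafData} {μ : ℕ} (hY : ∀ y ∈ (Y : Set X), idealOrder J y = μ) {x : X}
    (hx : x ∈ (Y : Set X)) {ζ : X} (hζY : ζ ∉ (Y : Set X)) (hζ : ζ ⤳ x)
    (hord : (μ : ℕ∞) ≤ idealOrder J ζ) :
    ∃ (ζ' x' : X'), π ζ' = ζ ∧ ζ' ⤳ x' ∧ π x' = x ∧ IsNear π (vanishingIdeal Y) J μ x' := by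
  have hζs : ζ ∉ ((vanishingIdeal Y).support : Set X) := by
    rw [coe_support_vanishingIdeal]; exact hζY
  obtain ⟨ζ', hζ'⟩ := hπ.exists_preimage_of_not_mem_support hζs
  have hord' : (μ : ℕ∞) ≤ idealOrder (controlledTransform π (vanishingIdeal Y) J μ) ζ' := by
    rw [hπ.idealOrder_controlledTransform_of_not_mem J μ (by rw [hζ']; exact hζs), hζ']
    exact hord
  obtain ⟨x', hsp, hx', hnear⟩ :=
    hπ.exists_isNear_of_specializes hX hX' hreg hY hx (by rw [hζ']; exact hζ) hord'
  exact ⟨ζ', x', hζ', hsp, hx', hnear⟩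

/-! ## Lemma 4.3 (1), moreover: `τ = 3` points are isolated in `Σ` -/

set_option maxHeartbeats 400000 in
/-- **[CoP1] Lemma 4.3 (1), "moreover `x` is an isolated point of `Σ`".** `X` regular locally
Noetherian, `x` a CLOSED point of embedding dimension `3` with `ord_x J = μ` and `τ_x(J, μ) = 3`.
Then no generization `ζ ≠ x` of `x` has `ord_ζ J ≥ μ`: blowing up `x` (a permissible centre) would
produce a near point over `x` (`IsBlowup.exists_isNear_of_specializes_of_not_mem`), which
`τ(x) = 3` forbids (`IsBlowup.not_isNear_of_stalkTau_eq_three`).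
[cite: CossartPiltant2008, Lemma 4.3 (1)] -/
theorem eq_of_specializes_of_stalkTau_eq_three [IsLocallyNoetherian X] (hX : Scheme.IsRegular X)
    (J : X.IdealSheafData) {μ : ℕ} {x : X} (hxc : IsClosed ({x} : Set X))
    (hd : (maximalIdeal (X.presheaf.stalk x)).spanFinrank = 3) (hordx : idealOrder J x = μ)
    (hτ : haveI := hX x; stalkTau J x μ = 3) {ζ : X} (hζ : ζ ⤳ x)
    (hord : (μ : ℕ∞) ≤ idealOrder J ζ) : ζ = x := by
  by_contra hne
  set D : Closeds X := ⟨{x}, hxc⟩ with hD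
  have hreg : Scheme.IsRegular (vanishingIdeal D).subscheme := isRegular_subscheme_vanishingIdeal_point hxc
  have hY : ∀ y ∈ (D : Set X), idealOrder J y = μ := fun y hy => by
    have hy' : y = x := hy
    rw [hy']; exact hordx
  obtain ⟨X', π, hπ⟩ := exists_isBlowup X (vanishingIdeal D)
  haveI : IsProper π := hπ.isProper
  haveI : IsLocallyNoetherian X' := LocallyOfFiniteType.isLocallyNoetherian π
  have hX' : Scheme.IsRegular X' := hπ.isRegular_of_isRegular_subscheme hX hreg
  obtain ⟨ζ', x', -, -, hx', hnear⟩ := hπ.exists_isNear_of_specializes_of_not_mem hX hX' hreg hY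
    (show x ∈ (D : Set X) from rfl) (show ζ ∉ (D : Set X) from hne) hζ hord
  -- the data at `x`, read at `π x'`
  subst hx'
  haveI : IsRegularLocalRing (X.presheaf.stalk (π x')) := hX (π x')
  obtain ⟨c₀, hc₀⟩ := exists_regularSystemOfParameters (R := X.presheaf.stalk (π x'))
  let c : Fin 3 → X.presheaf.stalk (π x') := fun i => c₀ (i.cast hd.symm)
  have hrange : Set.range c = Set.range c₀ := by
    ext a
    constructor
    · rintro ⟨i, rfl⟩; exact ⟨i.cast hd.symm, rfl⟩
    · rintro ⟨i, rfl⟩; exact ⟨i.cast hd, by simp [c]⟩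
  have hc : Ideal.span (Set.range c) = maximalIdeal _ := by rw [hrange, hc₀]
  have hcY : Ideal.span (Set.range c) = stalkIdeal (vanishingIdeal D) (π x') := by
    rw [hc, hD, stalkIdeal_vanishingIdeal_singleton hxc]
  exact hπ.not_isNear_of_stalkTau_eq_three hd hc hcY hτ hnear

/-! ## Lemma 4.3 (2), moreover: at `τ ≥ 2` a permissible curve is all of `Σ` locally -/

/-- **[CoP1] Lemma 4.3 (2), "moreover `Y` and `Σ` coincide locally at `x`".** `X` regular locally
Noetherian, `Y` a regular closed curve with `ord_y J = μ ≥ 1` along it, whose ideal at `x ∈ Y` is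
generated by a codimension-`2` part `(c₁, c₂)` of a regular system of parameters, and `τ_x(J, μ) ≥ 2`.
Then every generization `ζ` of `x` with `ord_ζ J ≥ μ` lies on `Y`: otherwise blowing up `Y` would
produce a near point over `x` (`IsBlowup.exists_isNear_of_specializes_of_not_mem`), which
`τ(x) ≥ 2` forbids over a curve centre (`IsBlowup.not_isNear_of_two_le_stalkTau`).
[cite: CossartPiltant2008, Lemma 4.3 (2)] -/
theorem mem_of_specializes_of_two_le_stalkTau [IsLocallyNoetherian X] (hX : Scheme.IsRegular X)
    (J : X.IdealSheafData) {μ : ℕ} (hμ : 1 ≤ μ) (Y : Closeds X)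
    (hreg : Scheme.IsRegular (vanishingIdeal Y).subscheme) (hY : ∀ y ∈ (Y : Set X), idealOrder J y = μ)
    {x : X} (hx : x ∈ (Y : Set X)) {c : Fin 2 → X.presheaf.stalk x}
    (hcr : haveI := hX x; IsRsopPart c) (hcY : Ideal.span (Set.range c) = stalkIdeal (vanishingIdeal Y) x)
    (hτ : haveI := hX x; 2 ≤ stalkTau J x μ) {ζ : X} (hζ : ζ ⤳ x)
    (hord : (μ : ℕ∞) ≤ idealOrder J ζ) : ζ ∈ (Y : Set X) := by
  by_contra hζY
  obtain ⟨X', π, hπ⟩ := exists_isBlowup X (vanishingIdeal Y)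
  haveI : IsProper π := hπ.isProper
  haveI : IsLocallyNoetherian X' := LocallyOfFiniteType.isLocallyNoetherian π
  have hX' : Scheme.IsRegular X' := hπ.isRegular_of_isRegular_subscheme hX hreg
  obtain ⟨ζ', x', -, -, hx', hnear⟩ :=
    hπ.exists_isNear_of_specializes_of_not_mem hX hX' hreg hY hx hζY hζ hord
  subst hx'
  haveI : IsRegularLocalRing (X.presheaf.stalk (π x')) := hX (π x')
  exact hπ.not_isNear_of_two_le_stalkTau hX hreg hμ hY hcr hcY hτ hnear

/-! ## The point centre with `τ = 2`: all branches of `Σ` pass through the near point -/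

/-- **At `τ(x) = 2`, every point of `Σ′` whose image specializes to the closed point `x` (the
centre) specializes to THE near point over `x`.** `X, X′` regular locally Noetherian, `π` the blowing
up of the closed point `x` of embedding dimension `3`, `ord_x J = μ`, `τ(x) = 2`, `x₁` near over `x`;
then `ζ′ ⤳ x₁` for every `ζ′` with `π ζ′ ⤳ x` and `ord_{ζ′} J′ ≥ μ` (existence of a near
specialization, and uniqueness of the near point, [CoP1] Lemma 4.3 (3)). In [CoP1]'s words (proof
of Prop. 4.4): the strict transform of `Σ` passes through the near point.
[cite: CossartPiltant2008, Lemma 4.3 (3); proof of Prop. 4.4, p. 9–11] -/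
theorem IsBlowup.specializes_of_isNear_of_stalkTau_eq_two [IsLocallyNoetherian X]
    [IsLocallyNoetherian X'] (hX : Scheme.IsRegular X) (hX' : Scheme.IsRegular X') {x : X}
    (hxc : IsClosed ({x} : Set X)) (hπ : IsBlowup π (vanishingIdeal ⟨{x}, hxc⟩))
    {J : X.IdealSheafData} {μ : ℕ} (hordx : idealOrder J x = μ) {x₁ : X'} (hx₁ : π x₁ = x)
    (hd : haveI := hX (π x₁); (maximalIdeal (X.presheaf.stalk (π x₁))).spanFinrank = 3)
    {c : Fin 3 → X.presheaf.stalk (π x₁)} (hc : Ideal.span (Set.range c) = maximalIdeal _)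
    (hcY : Ideal.span (Set.range c) = stalkIdeal (vanishingIdeal ⟨{x}, hxc⟩) (π x₁))
    (hτ : haveI := hX (π x₁); stalkTau J (π x₁) μ = 2)
    (hnear₁ : IsNear π (vanishingIdeal ⟨{x}, hxc⟩) J μ x₁) {ζ' : X'} (hζ : π ζ' ⤳ x)
    (hord : (μ : ℕ∞) ≤ idealOrder (controlledTransform π (vanishingIdeal ⟨{x}, hxc⟩) J μ) ζ') :
    ζ' ⤳ x₁ := by
  have hreg : Scheme.IsRegular (vanishingIdeal ⟨{x}, hxc⟩).subscheme :=
    isRegular_subscheme_vanishingIdeal_point hxc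
  have hY : ∀ y ∈ ((⟨{x}, hxc⟩ : Closeds X) : Set X), idealOrder J y = μ := fun y hy => by
    have hy' : y = x := hy
    rw [hy']; exact hordx
  obtain ⟨x', hsp, hx', hnear⟩ :=
    hπ.exists_isNear_of_specializes hX hX' hreg hY (show x ∈ (({x} : Set X)) from rfl) hζ hord
  haveI : IsRegularLocalRing (X.presheaf.stalk (π x₁)) := hX (π x₁)
  haveI : IsRegularLocalRing (X'.presheaf.stalk x₁) := hX' x₁
  have heq : x' = x₁ :=
    hπ.eq_of_isNear_of_isNear_point hd hc hcY hτ hnear₁ hnear (hx'.trans hx₁.symm)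
  rw [← heq]; exact hsp

end Literature.AlgebraicGeometry.Resolution

end
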